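import Literature.MathematicalPhysics.QuantumFieldTheory.Balaban1983to89.B9Letters313AtOneL2Dir
import Literature.MathematicalPhysics.QuantumFieldTheory.Balaban1983to89.B9Letters313AtOneL2DD
import Literature.MathematicalPhysics.QuantumFieldTheory.Balaban1983to89.B9Letters313AtOneL2Qflat

/-!
# `Balaban1983to89.B9Letters313AtOneL2Pack` — [B9] Thm 3.13's BLOCK-L² reduction letters AT THE TRIVIAL BACKGROUND, packaged: EIGHT fields of
# dag-n06-d's `hLL2` (`Letters313L2PZ.gDv ∕ dGDv ∕ gQs ∕ ddGQs ∕ dGQs ∕ q`, `Letters313L2MZ.dGDvd ∕ dGQsd`) at `U = 1` with ONE constant triple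

T. Bałaban, *Propagators for lattice gauge theories in a background field*, Commun. Math. Phys. **99** (1985) 389–434
[`Balaban1985BackgroundPropagators`, "B9"]; [4] = T. Bałaban, *Propagators and renormalization transformations for lattice gauge
theories. II*, Commun. Math. Phys. **96** (1984) 223–250 [`Balaban1984PropagatorsII`].

statement-level skeleton of published theorems with citation tags; proofs where landed; nothing here is a claim about the Yang–Mills mass gap

THE PRINTED LOCI (verbatim).  [B9] p. 426 (Thm 3.13), (3.153); (3.46) p. 398; Cor. 3.5 p. 407; [4] Prop. 2.6 (2.140) p. 247, Lemma 2.1 (2.60)–(2.61) p. 234.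

THE POINT.  The certificate's binder (editions 22–24; edition 24 `…V6EPairNE` is the record, same pins `hblk12 hblkY12 hblkZ12 hblkW12 hG0co12 hQco12
hQsco12 hDvco12 hDco12 h𝔡Ad`) is `hLL2 : ∀ x, M12 ≤ M → … → Letters313L2PZ (𝔬12 x) (𝔡A x).Dd (𝔡A x).Dsd 1 (H x) B13₄ δ12₃ (√wZ) _ U ∧ Letters313L2MZ
…` with ONE constant `B13₄` and ONE rate `δ12₃` for all fields and all members.  The letter files `B9Letters313AtOneL2Dv ∕ …L2Dir ∕ …L2DD ∕ …L2Qflat`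
each give their fields at `U ↦ 1` with their own `(M₁, B₄, δ₄)` and with the reading constant `cR39 b` (resp. `(cR39 b)⁻¹`) displayed; since the
basis `b` (`trBasis N`) is fixed BEFORE the member `x`, THIS FILE quantifies `b` first and packages ★★★ `letters313_L2_pack_one_kIdx`: for every
basis with `cR39 b ≠ 0` there is ONE triple `M₁, B₄, δ₄ > 0` such that, for every index `i` with `M₁ ≤ M` and every letter record pinned as in the
certificate at a configuration reading `1`, the eight fields hold with kernels LITERALLY of the shapes of `Letters313L2PZ ∕ Letters313L2MZ`
(`vZ := √wZ`): `B₄·len y·e^{−δ₄d}`, `B₄·e^{−δ₄d}`, `B₄·len y·(vZ y′·len y′)·e^{−δ₄d}`, `B₄·((len y)⁻¹·(vZ y′·len y′))·e^{−δ₄d}` (every pair),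
`B₄·(vZ y′·len y′)·e^{−δ₄d}`, `B₄·(vZ y·len y·(len y′)⁻¹)·e^{−δ₄d}`, and direction-wise `B₄·e^{−δ₄d}`, `B₄·(vZ y′·len y′)·e^{−δ₄d}` — slower rates and
larger constants by kernel monotonicity.

HONEST SCOPE.  A PACKAGING file over this seat's reading files; nothing of [B9] at curved `U` asserted; `hLL2` NOT witnessed: of its fifteen fields the
four R-letters (`rgdI ∕ rgdDs ∕ rgdDds ∕ rgdDd`), the inverse letter `c1` and the pair letter `ddGDv` (no third-order member `∇∇G∇*` in the k-level
census as typed) remain OPEN at `U = 1`.  COUNT-NEUTRAL; N06 NOT discharged; one finite lattice at a time; nothing continuum, nothing about the mass gap.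
Cell `pub-ymgap` (HUMAN RULING D-0062 ∕ D-0149), node N06 [B9], rows 20–21 JSAT lane, width seat `pub-ymgap-dag-n06-w3` (g2), 2026-08-28.
-/

noncomputable section

namespace Literature.MathematicalPhysics.QuantumFieldTheory.Balaban1983to89.B9Letters313AtOneL2Pack

open B6Geom246MultiLevelTorus (geomT) open B6GlobalChartV1 (PV blkV1)
open B6KLevelCensusIndexV1 (KIdx kGeo kGeoG) open B6Prop26Census2136KLevelV1 (Gop) open B6Ineq2142KLevelV1 (lvl β) open B9GeoNormsKLevelV1 (geo9K)
open B9GeoLemma21KLevelV1 (one_le_Mh geo9K_len_pos geo9K_dist_comm geo9K_M_nonneg geo9K_one_le_L) open B9Thm39ReadingCoords (cR39 cR39_nonneg)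
open B9CoReadingCoords B9CoReadingCoordsH open B9CoReadingCoordsS (XSK blkSK sIK) open B9Thm34Ext (toB6) open B9SectDL2Decay (bsq bl2 BlockBd)
open B9Thm314GpFlatMultiLevelTorus (consts_260_261) open B6Lemma21Repaired (Ineq261With) open B9Letters313AtOneQ (transfer_threshold)
open B9Prop26L2AtPinsOne (blockBd_Gop_kIdx) open B9Letters313AtOneL2 (blockBd_G0_Qstar_one blockBd_D_G0_Qstar_one)
open B9Letters313AtOneL2Dv (blockBd_G0_Dv_one blockBd_D_G0_Dv_one) open B9Letters313AtOneL2Dir (blockBd_Dd_G0_Qstar_one blockBd_Dd_G0_Dv_one)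
open B9Letters313AtOneL2DD (blockBd_DdDd_G0_Qstar_one) open B9Letters313AtOneL2Qflat (letters313_L2_q_one_kIdx)
open Node00 Node00.OpsYSectDCoords B9Thm312Whole
open scoped Matrix

variable {d ℓ : ℕ} {hd : 1 ≤ d + 1} {hL : Odd (ℓ + 1) ∧ 1 < ℓ + 1} {b₀ b₁ : ℝ}

variable {𝔸 : Type} [NormedRing 𝔸] [NormedAlgebra ℂ 𝔸] [CompleteSpace 𝔸] [FiniteDimensional ℝ 𝔸]
variable {κ : Type} [Fintype κ]

/-- ★★★ **EIGHT FIELDS OF `hLL2` AT `U = 1` WITH ONE CONSTANT TRIPLE.**  For every basis `b` with `cR39 b ≠ 0` there are `M₁, B₄, δ₄ > 0` such that for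
every index `i` with `M₁ ≤ M`, every letter record `𝔬` over `geo9K i` (carriers `XBK ∕ XBK ∕ XHK ∕ XSK`) pinned at a configuration reading `1` as in
dag-n06-d's certificate (`hblk12 hblkY12 hblkZ12` + site pin `blkW = blkSK (sIK bI)`, `hG0co12 hQco12 hQsco12 hDvco12 hDco12`) and every direction
family pinned by `h𝔡Ad`, the fields `gDv`, `dGDv`, `gQs`, `ddGQs q` (every pair), `dGQs`, `q` of `Letters313L2PZ` and `dGDvd ν`, `dGQsd ν` (every `ν`)
of `Letters313L2MZ` hold at `U₁` with constant `B₄`, rate `δ₄` and `vZ = √wZ`, in the record's literal kernel shapes.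
[cite: Balaban1985BackgroundPropagators, Thm 3.13 p.426, (3.46) p.398, Cor. 3.5 p.407; Balaban1984PropagatorsII, Prop. 2.6 (2.140) p.247, Lemma 2.1 (2.60)–(2.61) p.234] -/
theorem letters313_L2_pack_one_kIdx (hb₀ : 0 < b₀) (hb₁ : b₀ ≤ b₁) (b : Module.Basis κ ℝ 𝔸) (hc : cR39 b ≠ 0) :
    ∃ M₁ B₄ δ₄ : ℝ, 0 < M₁ ∧ 0 < B₄ ∧ 0 < δ₄ ∧
    ∀ i : KIdx d ℓ hd hL b₀ b₁, M₁ ≤ (geo9K i).M → ∀ (hG : GeoOK (geo9K i)) [Fintype (geo9K i).Site]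
      (B : B9.Backgrounds) (cfg : B.Cfg → CfgY 𝔸 i) (O : BondOpY 𝔸 i) (parB : BondParY 𝔸 i),
      (∀ s s', parB (fun _ _ => 1) s s' = 1) → (∀ (J : FBondY i → ℝ) (E : 𝔸), O (fun _ _ => 1) (liftY J E) = liftY (Gop i J) E) →
      ∀ {U₁ : B.Cfg}, cfg U₁ = (fun _ _ => 1) → ∀ {bI : FBondY i → IBondY i},
      (∀ f : FBondY i, lvl i.hN i.D i.hk (bI f) = (blkV1 i.hN i.D f).1.1) →
      (∀ f : FBondY i, (geomT i.D).dist (β i.hN i.D i.hk (bI f)) (blkV1 i.hN i.D f) ≤ 1) →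
      ∀ (𝔬 : Ops (geo9K i) B (XBK κ i) (XBK κ i) (XHK κ i) (XSK κ i)),
      𝔬.blk = blkBK i bI → 𝔬.blkY = blkBK i bI → 𝔬.blkZ = blkHK i → 𝔬.blkW = blkSK i (sIK i bI) →
      𝔬.G0 U₁ = GcoK i b B cfg O U₁ → 𝔬.Q U₁ = QcoKH i b B cfg parB U₁ → 𝔬.Qstar U₁ = QscoKH i b B cfg parB U₁ →
      𝔬.Dv U₁ = DvcoKH i b B cfg U₁ → 𝔬.D U₁ = DcoK i b B cfg U₁ →
      ∀ (Dd : B.Cfg → Fin (d + 1) → Module.End ℝ (XBK κ i → ℝ)),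
      Dd U₁ = (fun μ => coordOpK b (fun _ : Fin (d + 1) => cdBₗ i (cfg U₁) μ)) →
      ∀ {R₀ : ℝ} {H₀ : Prop},
        BlockBd (g := toB6 (geo9K i) R₀ H₀) 𝔬.blkW 𝔬.blk (𝔬.G0 U₁ ∘ₗ 𝔬.Dv U₁)
          (fun y y' => B₄ * (geo9K i).len y * Real.exp (-(δ₄ * (geo9K i).dist y y'))) ∧
        BlockBd (g := toB6 (geo9K i) R₀ H₀) 𝔬.blkW 𝔬.blkY (𝔬.D U₁ ∘ₗ 𝔬.G0 U₁ ∘ₗ 𝔬.Dv U₁)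
          (fun y y' => B₄ * Real.exp (-(δ₄ * (geo9K i).dist y y'))) ∧
        BlockBd (g := toB6 (geo9K i) R₀ H₀) 𝔬.blkZ 𝔬.blk (𝔬.G0 U₁ ∘ₗ 𝔬.Qstar U₁)
          (fun y y' => B₄ * (geo9K i).len y * (Real.sqrt (((((ℓ + 1 : ℕ) : ℝ) ^ (d + 1)) ^ lvl i.hN i.D i.hk y')⁻¹) * (geo9K i).len y') *
            Real.exp (-(δ₄ * (geo9K i).dist y y'))) ∧
        (∀ q : Fin (d + 1) × Fin (d + 1),
          BlockBd (g := toB6 (geo9K i) R₀ H₀) 𝔬.blkZ 𝔬.blk ((Dd U₁ q.1 ∘ₗ Dd U₁ q.2) ∘ₗ 𝔬.G0 U₁ ∘ₗ 𝔬.Qstar U₁)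
            (fun y y' => B₄ * (((geo9K i).len y)⁻¹ * (Real.sqrt (((((ℓ + 1 : ℕ) : ℝ) ^ (d + 1)) ^ lvl i.hN i.D i.hk y')⁻¹) * (geo9K i).len y')) *
              Real.exp (-(δ₄ * (geo9K i).dist y y')))) ∧
        BlockBd (g := toB6 (geo9K i) R₀ H₀) 𝔬.blkZ 𝔬.blkY (𝔬.D U₁ ∘ₗ 𝔬.G0 U₁ ∘ₗ 𝔬.Qstar U₁)
          (fun y y' => B₄ * (Real.sqrt (((((ℓ + 1 : ℕ) : ℝ) ^ (d + 1)) ^ lvl i.hN i.D i.hk y')⁻¹) * (geo9K i).len y') *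
            Real.exp (-(δ₄ * (geo9K i).dist y y'))) ∧
        BlockBd (g := toB6 (geo9K i) R₀ H₀) 𝔬.blk 𝔬.blkZ (𝔬.Q U₁)
          (fun y y' => B₄ * (Real.sqrt (((((ℓ + 1 : ℕ) : ℝ) ^ (d + 1)) ^ lvl i.hN i.D i.hk y)⁻¹) * (geo9K i).len y * ((geo9K i).len y')⁻¹) *
            Real.exp (-(δ₄ * (geo9K i).dist y y'))) ∧
        (∀ ν : Fin (d + 1),
          BlockBd (g := toB6 (geo9K i) R₀ H₀) 𝔬.blkW 𝔬.blk (Dd U₁ ν ∘ₗ 𝔬.G0 U₁ ∘ₗ 𝔬.Dv U₁)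
            (fun y y' => B₄ * Real.exp (-(δ₄ * (geo9K i).dist y y')))) ∧
        (∀ ν : Fin (d + 1),
          BlockBd (g := toB6 (geo9K i) R₀ H₀) 𝔬.blkZ 𝔬.blk (Dd U₁ ν ∘ₗ 𝔬.G0 U₁ ∘ₗ 𝔬.Qstar U₁)
            (fun y y' => B₄ * (Real.sqrt (((((ℓ + 1 : ℕ) : ℝ) ^ (d + 1)) ^ lvl i.hN i.D i.hk y')⁻¹) * (geo9K i).len y') *
              Real.exp (-(δ₄ * (geo9K i).dist y y')))) := by
  obtain ⟨M₁, δ₃, C, hM₁, hδ₃, hC, H⟩ := blockBd_Gop_kIdx (d := d) (ℓ := ℓ) (hd := hd) (hL := hL) hb₀ hb₁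
  obtain ⟨N, c, -, hc0, hcon⟩ := consts_260_261 d ℓ hδ₃
  have hcb : 0 ≤ cR39 b := cR39_nonneg b
  have hcbi : 0 ≤ (cR39 b)⁻¹ := inv_nonneg.2 hcb
  set Lr : ℝ := (((ℓ + 1 : ℕ) : ℝ)) with hLr
  have hLr1 : 1 ≤ Lr := by rw [hLr]; exact_mod_cast Nat.succ_le_succ (Nat.zero_le ℓ)
  set lg : ℝ := Real.log Lr with hlg
  have hlg0 : 0 ≤ lg := Real.log_nonneg hLr1
  set AQ : ℝ := C * c * Real.exp (3 / 4 * δ₃ * ((ℓ : ℝ) + 4)) * Real.sqrt (Real.exp (1 / 4 * δ₃) * c) * Lr with hAQ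
  set AD : ℝ := ((d : ℝ) + 1) * (C * c * Real.exp (3 / 4 * δ₃ * 3) * Real.sqrt (Real.exp (1 / 4 * δ₃) * c)) with hAD
  set Bq : ℝ := Lr * Real.exp ((δ₃ / 2 + 1) * ((ℓ : ℝ) + 4)) * (cR39 b)⁻¹ with hBq
  have hAQ0 : 0 ≤ AQ := by positivity
  have hAD0 : 0 ≤ AD := by positivity
  have hBq0 : 0 ≤ Bq := by positivity
  have hcAD0 : 0 ≤ cR39 b * AD := mul_nonneg hcb hAD0
  set B₄ : ℝ := AQ + cR39 b * AD + Bq + 1 with hB₄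
  have hB₄pos : 0 < B₄ := by positivity
  have hAQB : AQ ≤ B₄ := by linarith
  have hADB : cR39 b * AD ≤ B₄ := by linarith
  have hBqB : Bq ≤ B₄ := by linarith
  refine ⟨max (max (max M₁ ((N : ℝ) + 1)) (4 * lg / δ₃)) lg, B₄, δ₃ / 2, ?_, hB₄pos, by positivity, ?_⟩
  · exact lt_max_of_lt_left (lt_max_of_lt_left (lt_max_of_lt_left hM₁))
  intro i hM hG _ B cfg O parB hparB hO U₁ hU₁ bI hlev hβ1 𝔬 hblk hblkY hblkZ hblkW hG0 hQ hQs hDv hD Dd hDd R₀ H₀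
  have hM' : max (max M₁ ((N : ℝ) + 1)) (4 * lg / δ₃) ≤ (geo9K i).M := (le_max_left _ _).trans hM
  have hMlg : lg ≤ (geo9K i).M := (le_max_right _ _).trans hM
  have hLcast : (((ℓ + 1 : ℕ) : ℝ)) = (ℓ : ℝ) + 1 := by push_cast; ring
  have hMdef : (geo9K i).M = (((ℓ + 1 : ℕ) : ℝ)) * (i.Mh : ℝ) := rfl
  have hLdef : (geo9K i).L = Lr := rfl
  have hM₁ : M₁ ≤ (kGeoG i).M := ((le_max_left _ _).trans (le_max_left _ _)).trans hM'
  have hN : (N : ℝ) + 1 ≤ ((ℓ : ℝ) + 1) * i.Mh := by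
    rw [← hLcast, ← hMdef]; exact ((le_max_right _ _).trans (le_max_left _ _)).trans hM'
  have hMw : 4 * lg ≤ (geo9K i).M * δ₃ := (div_le_iff₀ hδ₃).mp ((le_max_right _ _).trans hM')
  have hR1 : 1 ≤ i.R := le_trans (by omega) (toKT i).hR
  have hRN : N + 1 ≤ i.R * ((ℓ + 1) * i.Mh) := by
    have h2 : N + 1 ≤ (ℓ + 1) * i.Mh := by exact_mod_cast hN
    calc N + 1 ≤ 1 * ((ℓ + 1) * i.Mh) := by rw [one_mul]; exact h2
      _ ≤ i.R * ((ℓ + 1) * i.Mh) := Nat.mul_le_mul_right _ hR1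
  obtain ⟨-, h261⟩ := hcon i.k i.Mh i.R i.P' (one_le_Mh i) (toKT i).hP hRN
  have h261D : Ineq261With c (geomT i.D) δ₃ (1 / 4) := h261 i.D
  obtain ⟨-, h1, h2, h3, h4, -⟩ := H i hM₁
  have hε4 : 0 < δ₃ / 4 := by positivity
  have hMg1 : ((1 : ℕ) : ℝ) * lg / (δ₃ / 4) ≤ (geo9K i).M := by rw [div_le_iff₀ hε4]; push_cast; linarith
  have hT1 := transfer_threshold i hε4 1 hMg1
  -- the eight bodies
  have hQb := blockBd_G0_Qstar_one (Y := XBK κ i) (W := XSK κ i) (R₀ := R₀) (H₀ := H₀) i b B cfg O parB hG hc hparB hO hU₁ hlev hβ1 𝔬 hblk hblkZ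
    hG0 hQs hC.le hδ₃.le hc0 (H i hM₁).1 h261D hε4 (by simpa using hT1)
  have hDvb := blockBd_G0_Dv_one (Y := XBK κ i) (Z := XHK κ i) (R₀ := R₀) (H₀ := H₀) i b B cfg O hG hO hU₁ hlev hβ1 𝔬 hblk hblkW hG0 hDv
    hC.le hδ₃.le hc0 h2 h261D
  have hDQ := blockBd_D_G0_Qstar_one (W := XSK κ i) (R₀ := R₀) (H₀ := H₀) i b B cfg O parB hG hc hparB hO hU₁ hlev hβ1 𝔬 hblkY hblkZ hG0 hQs hD
    hC.le hδ₃.le hc0 h1 h261D hε4 (by simpa using hT1)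
  have hDD := blockBd_D_G0_Dv_one (Z := XHK κ i) (R₀ := R₀) (H₀ := H₀) i b B cfg O hG hO hU₁ hlev hβ1 𝔬 hblkY hblkW hG0 hDv hD
    hC.le hδ₃.le hc0 h3 h261D
  have hDDQ := fun q : Fin (d + 1) × Fin (d + 1) => blockBd_DdDd_G0_Qstar_one (Y := XBK κ i) (W := XSK κ i) (R₀ := R₀) (H₀ := H₀) i b B cfg O
    parB hG hc hparB hO hU₁ hlev hβ1 𝔬 hblk hblkZ hG0 hQs Dd hDd hC.le hδ₃.le hc0 h4 h261D hε4 (by simpa using hT1) q.1 q.2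
  have hqb := letters313_L2_q_one_kIdx (Y := XBK κ i) (W := XSK κ i) (R₀ := R₀) (H₀ := H₀) (half_pos hδ₃).le i hMlg hG b B cfg parB hparB hU₁
    hβ1 𝔬 hblk hblkZ hQ
  have hMdQ := fun ν : Fin (d + 1) => blockBd_Dd_G0_Qstar_one (Y := XBK κ i) (W := XSK κ i) (R₀ := R₀) (H₀ := H₀) i b B cfg O parB hG hc hparB
    hO hU₁ hlev hβ1 𝔬 hblk hblkZ hG0 hQs Dd hDd hC.le hδ₃.le hc0 h1 h261D hε4 (by simpa using hT1) ν
  have hMdD := fun ν : Fin (d + 1) => blockBd_Dd_G0_Dv_one (Y := XBK κ i) (Z := XHK κ i) (R₀ := R₀) (H₀ := H₀) i b B cfg O hG hO hU₁ hlev hβ1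
    𝔬 hblk hblkW hG0 hDv Dd hDd hC.le hδ₃.le hc0 h3 h261D ν
  -- kernel bookkeeping
  have hre : ∀ t : ℝ, Real.exp (-((3 / 4 * δ₃ - δ₃ / 4) * t)) = Real.exp (-(δ₃ / 2 * t)) := fun t => by congr 1; ring
  have hrate : ∀ y y' : (geo9K i).Site, Real.exp (-(3 / 4 * δ₃ * (geo9K i).dist y y')) ≤ Real.exp (-(δ₃ / 2 * (geo9K i).dist y y')) :=
    fun y y' => Real.exp_le_exp.2 (by nlinarith [hG.dnn y y'])
  have hv0 : ∀ y : (geo9K i).Site, 0 ≤ Real.sqrt (((((ℓ + 1 : ℕ) : ℝ) ^ (d + 1)) ^ lvl i.hN i.D i.hk y)⁻¹) := fun y => Real.sqrt_nonneg _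
  have hl0 : ∀ y : (geo9K i).Site, 0 ≤ (geo9K i).len y := fun y => (hG.lenpos y).le
  -- transfer-type kernels: `AQ·w·e^{−(¾δ₃−δ₃∕4)d} ≤ B₄·w·e^{−(δ₃∕2)d}`
  have hTQ : ∀ (y y' : (geo9K i).Site) {w : ℝ}, 0 ≤ w →
      C * c * Real.exp (3 / 4 * δ₃ * ((ℓ : ℝ) + 4)) * Real.sqrt (Real.exp (1 / 4 * δ₃) * c) * (geo9K i).L * w *
        Real.exp (-((3 / 4 * δ₃ - δ₃ / 4) * (geo9K i).dist y y')) ≤ B₄ * w * Real.exp (-(δ₃ / 2 * (geo9K i).dist y y')) := by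
    intro y y' w hw
    rw [hre, hLdef]
    calc C * c * Real.exp (3 / 4 * δ₃ * ((ℓ : ℝ) + 4)) * Real.sqrt (Real.exp (1 / 4 * δ₃) * c) * Lr * w * Real.exp (-(δ₃ / 2 * (geo9K i).dist y y'))
        = AQ * (w * Real.exp (-(δ₃ / 2 * (geo9K i).dist y y'))) := by rw [hAQ]; ring
      _ ≤ B₄ * (w * Real.exp (-(δ₃ / 2 * (geo9K i).dist y y'))) := mul_le_mul_of_nonneg_right hAQB (by positivity)
      _ = _ := by ring
  -- slice-type kernels: `cR39 b·AD·w·e^{−¾δ₃d} ≤ B₄·w·e^{−(δ₃∕2)d}`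
  have hTD : ∀ (y y' : (geo9K i).Site) {w : ℝ}, 0 ≤ w →
      cR39 b * (((d : ℝ) + 1) * (C * c * Real.exp (3 / 4 * δ₃ * 3) * Real.sqrt (Real.exp (1 / 4 * δ₃) * c))) * w *
        Real.exp (-(3 / 4 * δ₃ * (geo9K i).dist y y')) ≤ B₄ * w * Real.exp (-(δ₃ / 2 * (geo9K i).dist y y')) := by
    intro y y' w hw
    calc cR39 b * (((d : ℝ) + 1) * (C * c * Real.exp (3 / 4 * δ₃ * 3) * Real.sqrt (Real.exp (1 / 4 * δ₃) * c))) * w *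
          Real.exp (-(3 / 4 * δ₃ * (geo9K i).dist y y'))
        = w * ((cR39 b * AD) * Real.exp (-(3 / 4 * δ₃ * (geo9K i).dist y y'))) := by rw [hAD]; ring
      _ ≤ w * (B₄ * Real.exp (-(δ₃ / 2 * (geo9K i).dist y y'))) :=
          mul_le_mul_of_nonneg_left (mul_le_mul hADB (hrate y y') (Real.exp_pos _).le hB₄pos.le) hw
      _ = _ := by ring
  refine ⟨?_, ?_, ?_, fun q => ?_, ?_, ?_, fun ν => ?_, fun ν => ?_⟩
  · refine B9SectDL2Decay.BlockBd.mono hDvb fun y y' => ?_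
    exact hTD y y' (hl0 y)
  · refine B9SectDL2Decay.BlockBd.mono hDD fun y y' => ?_
    have := hTD y y' (w := 1) zero_le_one
    simpa only [mul_one] using this
  · refine B9SectDL2Decay.BlockBd.mono hQb fun y y' => ?_
    have := hTQ y y' (w := (geo9K i).len y * (Real.sqrt (((((ℓ + 1 : ℕ) : ℝ) ^ (d + 1)) ^ lvl i.hN i.D i.hk y')⁻¹) * (geo9K i).len y'))
      (mul_nonneg (hl0 y) (mul_nonneg (hv0 y') (hl0 y')))
    calc _ = C * c * Real.exp (3 / 4 * δ₃ * ((ℓ : ℝ) + 4)) * Real.sqrt (Real.exp (1 / 4 * δ₃) * c) * (geo9K i).L *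
          ((geo9K i).len y * (Real.sqrt (((((ℓ + 1 : ℕ) : ℝ) ^ (d + 1)) ^ lvl i.hN i.D i.hk y')⁻¹) * (geo9K i).len y')) *
          Real.exp (-((3 / 4 * δ₃ - δ₃ / 4) * (geo9K i).dist y y')) := by ring
      _ ≤ _ := this
      _ = _ := by ring
  · refine B9SectDL2Decay.BlockBd.mono (hDDQ q) fun y y' => ?_
    exact hTQ y y' (mul_nonneg (inv_nonneg.2 (hl0 y)) (mul_nonneg (hv0 y') (hl0 y')))
  · refine B9SectDL2Decay.BlockBd.mono hDQ fun y y' => ?_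
    exact hTQ y y' (mul_nonneg (hv0 y') (hl0 y'))
  · refine B9SectDL2Decay.BlockBd.mono hqb fun y y' => ?_
    rw [hLdef]
    have hw : 0 ≤ Real.sqrt (((((ℓ + 1 : ℕ) : ℝ) ^ (d + 1)) ^ lvl i.hN i.D i.hk y)⁻¹) * (geo9K i).len y * ((geo9K i).len y')⁻¹ :=
      mul_nonneg (mul_nonneg (hv0 y) (hl0 y)) (inv_nonneg.2 (hl0 y'))
    calc Lr * Real.exp ((δ₃ / 2 + 1) * ((ℓ : ℝ) + 4)) * (cR39 b)⁻¹ *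
          (Real.sqrt (((((ℓ + 1 : ℕ) : ℝ) ^ (d + 1)) ^ lvl i.hN i.D i.hk y)⁻¹) * (geo9K i).len y * ((geo9K i).len y')⁻¹) *
          Real.exp (-(δ₃ / 2 * (geo9K i).dist y y'))
        = Bq * ((Real.sqrt (((((ℓ + 1 : ℕ) : ℝ) ^ (d + 1)) ^ lvl i.hN i.D i.hk y)⁻¹) * (geo9K i).len y * ((geo9K i).len y')⁻¹) *
          Real.exp (-(δ₃ / 2 * (geo9K i).dist y y'))) := by rw [hBq]; ring
      _ ≤ B₄ * ((Real.sqrt (((((ℓ + 1 : ℕ) : ℝ) ^ (d + 1)) ^ lvl i.hN i.D i.hk y)⁻¹) * (geo9K i).len y * ((geo9K i).len y')⁻¹) *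
          Real.exp (-(δ₃ / 2 * (geo9K i).dist y y'))) := mul_le_mul_of_nonneg_right hBqB (by positivity)
      _ = _ := by ring
  · refine B9SectDL2Decay.BlockBd.mono (hMdD ν) fun y y' => ?_
    have := hTD y y' (w := 1) zero_le_one
    simpa only [mul_one] using this
  · refine B9SectDL2Decay.BlockBd.mono (hMdQ ν) fun y y' => ?_
    exact hTQ y y' (mul_nonneg (hv0 y') (hl0 y'))

end Literature.MathematicalPhysics.QuantumFieldTheory.Balaban1983to89.B9Letters313AtOneL2Pack

end
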